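import Literature.NumberTheory.EllipticCurves.SqrtTwoTwistLSeriesCoefficients
import Literature.NumberTheory.EllipticCurves.SqrtTwoTwistBrewer
import Literature.NumberTheory.QuadraticFields.SqrtNegTwoPrimary
import HarnessLib

/-!
# `a_m(B_n) = (−n/m) · Σ_{x primary, N(x) = m} x` over `ℤ[√-2]` (Rajwade 1968, Thm. 1; modulo Brewer's character sum)

Topic `Literature/NumberTheory/EllipticCurves`, namespace `Literature.NumberTheory.EllipticCurves.SqrtTwoTwist` (sequel to
`SqrtTwoTwistLSeriesCoefficients`, `SqrtTwoTwistBrewer`).  THEOREMS ONLY.  The `ℤ[√-2]`-twin of `QuarticTwistHeckeCoefficients`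
(`a_n(E_D) = Σ_{x primary} \overline{(D/x)₄} x` over `ℤ[i]`): the coefficientwise form of «`L(B_n, s) = L(s, ψ_{B_n})`» for
`B_n : y² = x³ + 4n x² + 2n² x` (`n` odd, square-free; CM by `ℤ[√-2]`, `j = 8000`), read on Mathlib's `WeierstrassCurve.LFunction` and
the tree's `SqrtNegTwoPrimary` (Rajwade's primary elements `x ≡ 1, 3, 1 ± √-2, 3 ± √-2, 5 + 2√-2, 7 + 2√-2 (mod 4√-2)`):

  **`a_m(B_n) = (−n/m) · S(m)`,  `S(m) = Σ_{x ∈ ℤ[√-2] primary, N(x) = m} x`**   (`lFunction_eq_jacobiSym_mul_primarySum`),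

for every `m ≥ 1`, `(−n/m)` the Jacobi symbol — MODULO Brewer's theorem `Brewer1961_characterSum` (hypothesis `hB`), which supplies
the value `a_p(B_n) = −(−n/p)·2c` at the split primes.  This is Rajwade's Theorem 1 (`#E(𝔽_p) = p + 1 − (a/p)(π + π̄)`, `π` primary)
extended multiplicatively: both sides are multiplicative in `m` (Mathlib's `isMultiplicative_LFunction`; `primarySum_mul_of_coprime` and
`jacobiSym.mul_right`) and agree on prime powers by `SqrtTwoTwistLSeriesCoefficients` (`0` at `p ∣ 2n`; `(−p)^j, 0` at inert `p`;
`Σ (Jπ)^j (Jπ̄)^{k−j}` at split `p`, `J = (−n/p)`) against `SqrtNegTwoPrimary` (`S(2^{k+1}) = 0`; `S(p^{2j}) = (−p)^j`; `S(p^k) = Σ π^jπ̄^{k−j}`).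

* §1 `brewer_of_isPrimary` — the bridge between the two normalisations: if `π = a + b√-2` is PRIMARY of prime norm `p ≡ 1, 3 (mod 8)`
  then `c = −a`, `d = b` satisfy `p = c² + 2d²` and Brewer's `c ≡ (−1)^{⌊p/8⌋+1} (mod 4)` (a check modulo `16`); hence
  `a_p(B_n) = (−n/p)(π + π̄)` (`lFunction_B_apply_prime_eq_jacobiSym_mul`);
* §2 prime powers; §3 the theorem.

## References
* A. R. Rajwade, *Arithmetic on curves with complex multiplication by √−2*, Proc. Cambridge Philos. Soc. 64 (1968), Thm. 1. [Rajwade1968]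
* A. Silverberg, *Group order formulas for reductions of CM elliptic curves*, Contemp. Math. 521 (2010), Thm. 2.7. [Silverberg2010]
* P. A. Leonard, K. S. Williams, *Jacobi sums and a theorem of Brewer*, Rocky Mountain J. Math. 5 (1975), Theorem p. 301. [LeonardWilliams1975]
* K. Ireland, M. Rosen, *A Classical Introduction to Modern Number Theory*, 2nd ed., Ch. 18 §6, proof of Theorem 7 (the model).
  [IrelandRosen1990]

## Mathlib / tree search
Tree: `SqrtTwoTwist.{lFunction_B_apply_prime_pow_of_dvd, lFunction_B_apply_prime_pow_of_inert, lFunction_B_apply_prime_pow_of_split}`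
(`SqrtTwoTwistLSeriesCoefficients`), `lFunction_B_apply_prime_of_brewer`, `Brewer1961_characterSum` (`SqrtTwoTwistBrewer`),
`SqrtNegTwoPrimary.{primarySum, primarySum_one, primarySum_of_even, primarySum_mul_of_coprime, primarySum_pow_of_inert,
primarySum_pow_of_split, exists_isPrimary_norm_eq, natCast_eq_mul_star, IsPrimary, primaryRes, intCast_zmod_eight}`.  Mathlib:
`jacobiSym.{mul_right', pow_right, one_right}`, `legendreSym.{to_jacobiSym, sq_one, eq_zero_iff}`, `Nat.recOnPosPrimePosCoprime`.
-/

noncomputable section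

open scoped Classical

namespace Literature.NumberTheory.EllipticCurves

namespace SqrtTwoTwist

open _root_.WeierstrassCurve Literature.NumberTheory.QuadraticFields Literature.NumberTheory.QuadraticFields.SqrtNegTwoPrimary

variable {n : ℤ}

/-! ### §1 From Rajwade's primary `π` to Brewer's `(c, d)` -/

/-- **The two normalisations agree**: if `π = a + b√-2 ∈ ℤ[√-2]` is primary (Rajwade: `π ≡ 1, 3, 1 ± √-2, 3 ± √-2, 5 + 2√-2, 7 + 2√-2
(mod 4√-2)`) of prime norm `p ≡ 1, 3 (mod 8)`, then `c = −a`, `d = b` satisfy `p = c² + 2d²` and Brewer's normalisation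
`c ≡ (−1)^{k+1} (mod 4)`, `k = ⌊p/8⌋` (so that `a_p = −(−n/p)·2c = (−n/p)(π + π̄)`).  A check of `p = a² + 2b² (mod 16)` on the eight
classes of `H`. [cite: Silverberg2010, Thm. 2.7] [cite: LeonardWilliams1975, Theorem (p. 301)] -/
theorem brewer_of_isPrimary {p : ℕ} {π : ℤ√(-2)} (hπ : IsPrimary π) (h : π.norm = p) :
    (p : ℤ) = (-π.re) ^ 2 + 2 * π.im ^ 2 ∧ (-π.re) % 4 = (if (p / 8) % 2 = 0 then 3 else 1) := by
  have hp : (p : ℤ) = π.re * π.re + 2 * (π.im * π.im) := by rw [← h, norm_def']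
  refine ⟨by rw [hp]; ring, ?_⟩
  set a := π.re with ha
  set b := π.im with hb
  have hres : primaryRes (a : ZMod 8) (b : ZMod 8) := hπ
  rw [intCast_zmod_eight a, intCast_zmod_eight b] at hres
  -- `p ≡ (a mod 8)² + 2 (b mod 8)² (mod 16)`
  obtain ⟨K, hK⟩ : ∃ K : ℤ, (p : ℤ) = 16 * K + ((a % 8) ^ 2 + 2 * (b % 8) ^ 2) := by
    refine ⟨4 * (a / 8) ^ 2 + (a / 8) * (a % 8) + 8 * (b / 8) ^ 2 + 2 * (b / 8) * (b % 8), ?_⟩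
    have ha' : a = 8 * (a / 8) + a % 8 := by omega
    have hb' : b = 8 * (b / 8) + b % 8 := by omega
    rw [hp]
    conv_lhs => rw [ha', hb']
    ring
  have ha8 : a % 8 = 0 ∨ a % 8 = 1 ∨ a % 8 = 2 ∨ a % 8 = 3 ∨ a % 8 = 4 ∨ a % 8 = 5 ∨ a % 8 = 6 ∨ a % 8 = 7 := by omega
  have hb8 : b % 8 = 0 ∨ b % 8 = 1 ∨ b % 8 = 2 ∨ b % 8 = 3 ∨ b % 8 = 4 ∨ b % 8 = 5 ∨ b % 8 = 6 ∨ b % 8 = 7 := by omega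
  have hneg : (-a) % 4 = (-(a % 8)) % 4 := by omega
  rw [hneg]
  rcases ha8 with h1 | h1 | h1 | h1 | h1 | h1 | h1 | h1 <;>
  rcases hb8 with h2 | h2 | h2 | h2 | h2 | h2 | h2 | h2 <;>
  rw [h1, h2] at hres hK <;> simp only [Int.cast_ofNat, Int.cast_zero, Int.cast_one] at hres <;>
  first
    | exact absurd hres (by decide)
    | (rw [h1]; norm_num at hK ⊢; omega)

/-- **`a_p(B_n) = (−n/p)(π + π̄)` for `π` primary of norm `p ≡ 1, 3 (mod 8)`, `p ∤ n`** (Rajwade's Theorem 1, from Brewer's theorem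
`hB` through `brewer_of_isPrimary`), in `ℤ[√-2]`. [cite: Rajwade1968, Thm. 1] [cite: Silverberg2010, Thm. 2.7] -/
theorem lFunction_B_apply_prime_eq_jacobiSym_mul (hB : Brewer1961_characterSum) {p : ℕ} [Fact p.Prime]
    (hp8 : p % 8 = 1 ∨ p % 8 = 3) (hpn : ¬ (p : ℤ) ∣ n) {π : ℤ√(-2)} (hπ : IsPrimary π) (h : π.norm = p) :
    (((⟨0, 4 * (n : ℚ), 0, 2 * (n : ℚ) ^ 2, 0⟩ : WeierstrassCurve ℚ).LFunction p : ℤ) : ℤ√(-2)) =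
      (jacobiSym (-n) p : ℤ√(-2)) * (π + star π) := by
  obtain ⟨hcd, hc4⟩ := brewer_of_isPrimary (p := p) hπ h
  rw [lFunction_B_apply_prime_of_brewer hB hp8 hpn hcd hc4, jacobiSym.legendreSym.to_jacobiSym]
  have hsum : π + star π = ((2 * π.re : ℤ) : ℤ√(-2)) := by ext <;> simp [two_mul]
  rw [hsum]
  push_cast
  ring

/-! ### §2 The twisted primary sums at prime powers -/

/-- `(−n/p) = 0` in the Jacobi symbol at an odd prime `p ∣ n`. [cite: IrelandRosen1990, Ch. 5 §2 (Jacobi symbol)] -/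
private theorem jacobiSym_eq_zero_of_dvd {p : ℕ} [Fact p.Prime] (hpn : (p : ℤ) ∣ n) : jacobiSym (-n) p = 0 := by
  rw [← jacobiSym.legendreSym.to_jacobiSym, legendreSym.eq_zero_iff]
  have : ((n : ℤ) : ZMod p) = 0 := (ZMod.intCast_zmod_eq_zero_iff_dvd n p).mpr hpn
  push_cast
  rw [this, neg_zero]

/-- `(−n/p)² = 1` at an odd prime `p ∤ n`. [cite: IrelandRosen1990, Ch. 5 §2 (Jacobi symbol)] -/
private theorem jacobiSym_sq_eq_one {p : ℕ} [Fact p.Prime] (hpn : ¬ (p : ℤ) ∣ n) :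
    jacobiSym (-n) p ^ 2 = 1 := by
  rw [← jacobiSym.legendreSym.to_jacobiSym]
  refine legendreSym.sq_one p ?_
  intro h0
  apply hpn
  have : ((n : ℤ) : ZMod p) = 0 := by
    have h1 : ((-n : ℤ) : ZMod p) = 0 := by exact_mod_cast h0
    push_cast at h1
    exact neg_eq_zero.mp h1
  exact (ZMod.intCast_zmod_eq_zero_iff_dvd n p).mp this

/-! ### §3 Rajwade's Theorem 1, coefficient by coefficient -/

/-- `p ∤ 2n` splits as: `p ≠ 2` and `p ∤ n`. [cite: Rajwade1968, Thm. 1] -/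
private theorem ne_two_and_not_dvd {p : ℕ} (h : ¬ (p : ℤ) ∣ 2 * n) : p ≠ 2 ∧ ¬ (p : ℤ) ∣ n :=
  ⟨fun h2 ↦ h (h2 ▸ dvd_mul_right 2 n), fun hn ↦ h (hn.mul_left 2)⟩

/-- **Rajwade's Theorem 1 («`L(B_n, s) = L(s, ψ)`»), coefficient by coefficient, on Mathlib's `L`-function of
`B_n : y² = x³ + 4n x² + 2n² x`** (`n` odd and square-free), MODULO Brewer's character-sum theorem `hB`: for every `m ≥ 1`,
`a_m(B_n) = (−n/m) · Σ_{x ∈ ℤ[√-2] primary, N(x) = m} x` in `ℤ[√-2]` (Rajwade's primary generators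
`≡ 1, 3, 1 ± √-2, 3 ± √-2, 5 + 2√-2, 7 + 2√-2 (mod 4√-2)`).  Both sides are multiplicative and agree on prime powers.
[cite: Rajwade1968, Thm. 1] [cite: Silverberg2010, Thm. 2.7] [cite: IrelandRosen1990, Ch. 18 §6, proof of Theorem 7 (the model)] -/
theorem lFunction_eq_jacobiSym_mul_primarySum (hB : Brewer1961_characterSum) (hn : Squarefree n) (hodd : Odd n)
    {m : ℕ} (hm : m ≠ 0) :
    (((⟨0, 4 * (n : ℚ), 0, 2 * (n : ℚ) ^ 2, 0⟩ : WeierstrassCurve ℚ).LFunction m : ℤ) : ℤ√(-2)) =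
      (jacobiSym (-n) m : ℤ√(-2)) * primarySum m := by
  induction m using Nat.recOnPosPrimePosCoprime with
  | zero => exact absurd rfl hm
  | one =>
    rw [(⟨0, 4 * (n : ℚ), 0, 2 * (n : ℚ) ^ 2, 0⟩ : WeierstrassCurve ℚ).isMultiplicative_LFunction.map_one, jacobiSym.one_right,
      primarySum_one]
    simp
  | prime_pow p k hp hk =>
    haveI := Fact.mk hp
    obtain ⟨k', rfl⟩ : ∃ k', k = k' + 1 := ⟨k - 1, by omega⟩
    by_cases hp2n : (p : ℤ) ∣ 2 * n
    · -- additive prime: both sides vanish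
      rw [lFunction_B_apply_prime_pow_of_dvd hn hodd hp hp2n k', Int.cast_zero]
      by_cases hp2 : p = 2
      · subst hp2
        rw [primarySum_of_even (dvd_pow_self 2 (Nat.succ_ne_zero k')), mul_zero]
      · have hpn : (p : ℤ) ∣ n := by
          rcases (Nat.prime_iff_prime_int.mp hp).dvd_or_dvd hp2n with h2 | h
          · exact absurd ((Nat.prime_dvd_prime_iff_eq hp Nat.prime_two).mp (by exact_mod_cast h2)) hp2
          · exact h
        rw [jacobiSym.pow_right, jacobiSym_eq_zero_of_dvd hpn, zero_pow (Nat.succ_ne_zero k'), Int.cast_zero, zero_mul]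
    · obtain ⟨hp2, hpn⟩ := ne_two_and_not_dvd hp2n
      have hp8 : (p % 8 = 1 ∨ p % 8 = 3) ∨ (p % 8 = 5 ∨ p % 8 = 7) := by
        rcases hp.eq_two_or_odd with h | h
        · exact absurd h hp2
        · omega
      rcases hp8 with hsplit | hinert
      · -- split prime: `a_{p^k} = Σ (Jπ)^j (Jπ̄)^{k-j} = J^k S(p^k)`
        obtain ⟨π, hπ, hπp⟩ := exists_isPrimary_norm_eq (p := p) hsplit
        set J : ℤ√(-2) := (jacobiSym (-n) p : ℤ√(-2)) with hJ
        have hJ2 : J * J = 1 := by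
          rw [hJ, ← Int.cast_mul, ← pow_two, jacobiSym_sq_eq_one hpn, Int.cast_one]
        have h1 : (((⟨0, 4 * (n : ℚ), 0, 2 * (n : ℚ) ^ 2, 0⟩ : WeierstrassCurve ℚ).LFunction p : ℤ) : ℤ√(-2)) =
            J * π + J * star π := by
          rw [lFunction_B_apply_prime_eq_jacobiSym_mul hB hsplit hpn hπ hπp, mul_add]
        have hpπ : (p : ℤ√(-2)) = (J * π) * (J * star π) := by
          rw [natCast_eq_mul_star hπp]
          linear_combination (-(π * star π)) * hJ2
        rw [lFunction_B_apply_prime_pow_of_split hp hp2 hpn h1 hpπ (k' + 1), primarySum_pow_of_split hp hp2 hπ hπp (k' + 1),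
          jacobiSym.pow_right, Int.cast_pow, ← hJ, Finset.mul_sum]
        refine Finset.sum_congr rfl fun j hj ↦ ?_
        rw [Finset.mem_range] at hj
        rw [mul_pow, mul_pow, show J ^ (k' + 1) = J ^ j * J ^ (k' + 1 - j) by rw [← pow_add]; congr 1; omega]
        ring
      · -- inert prime
        have hJ2 : (jacobiSym (-n) p : ℤ√(-2)) ^ 2 = 1 := by
          rw [← Int.cast_pow, jacobiSym_sq_eq_one hpn, Int.cast_one]
        obtain ⟨j, hj | hj⟩ := Nat.even_or_odd' (k' + 1)
        · rw [hj, (lFunction_B_apply_prime_pow_of_inert hp hinert hpn j).1, (primarySum_pow_of_inert hinert j).1,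
            jacobiSym.pow_right, pow_mul]
          push_cast
          rw [hJ2, one_pow, one_mul]
        · rw [hj, (lFunction_B_apply_prime_pow_of_inert hp hinert hpn j).2, (primarySum_pow_of_inert hinert j).2,
            Int.cast_zero, mul_zero]
  | coprime a b ha hb hab iha ihb =>
    rw [(⟨0, 4 * (n : ℚ), 0, 2 * (n : ℚ) ^ 2, 0⟩ : WeierstrassCurve ℚ).isMultiplicative_LFunction.map_mul_of_coprime hab,
      Int.cast_mul, iha (by omega), ihb (by omega), primarySum_mul_of_coprime hab,
      jacobiSym.mul_right' (-n) (by omega) (by omega), Int.cast_mul]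
    ring

end SqrtTwoTwist

end Literature.NumberTheory.EllipticCurves

end
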